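import Literature.Analysis.FluidPDE.TypeIAncientMild
import HarnessLib

/-!
# Route `ExtremiserTransience`, crux `NearExtremalTransiencePerFlow` (stmt-NavierStokesRegularity-26567),
# LINE g10-α «dissipation ledger»: THE VOCABULARY OF THE STUBS C2, L1, L2 (texts of record)

Texts of record, VERBATIM §0–§1 of the registered skeleton of record
`Cruxes/NearExtremalTransiencePerFlow/Lines/dissipation_ledger.lean` (planner ns-idea-5 g10, skeleton sha a4e00292c54a;
`E3` spelled out as `EuclideanSpace ℝ (Fin 3)`), restricted to what the registered NON-heart stubs need, so that the stubs
`stub_ubiquityToLimit : UbiquityToLimit` (C2), `stub_dissipationBudget : DissipationBudget` (L1) and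
`stub_violatorDissipation : ViolatorDissipation` (L2) can be stated BY NAME in `Theorems/` files (a `Cruxes/` file is not
importable from `Theorems/`):

* `HasLinGrowthAllTime A W` — linear local-energy growth `∫_{B(x,R)}‖W τ‖² ≤ A·R` at every time `τ < 0`;
* `RadiallyUbiquitous g η w` — the level set `{‖w‖ ≥ η}` meets the `g`-neighbourhood of every sphere about `0`;
* `dissMeasure W` — the space–time dissipation measure, Lebesgue measure on `ℝ × ℝ³` with density `‖∇W(τ)(x)‖²`;
* `DissipationBudget` (L1), `ViolatorDissipation` (L2), `LedgerCount` (L3, proved in the line file),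
  `UbiquitousSliceLiouville` (the ledger's intermediate Liouville statement), `UbiquityToLimit` (C2).

All bodies are the line's, so the line's `stub_… : …` close by `exact` on the landed theorems (definitional unfolding).
Author: prover seat `ns-net-p1` (g11).  HONEST FRAMING: definitions only; nothing about Navier–Stokes regularity or blow-up
is proved here; no summit is proved by a line.
-/

noncomputable section

open scoped Topology ENNReal ContDiff
open MeasureTheory Filter Set Metric
open Literature.Analysis.FluidPDE

namespace Summit.NavierStokesRegularity.NavierStokesRegularity.Theorems.NearExtremalTransiencePerFlow.DissipationLedger

-- the problem directory repeats the summit name (`NavierStokesRegularity/NavierStokesRegularity`)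
set_option linter.dupNamespace false

/-- LINEAR LOCAL-ENERGY GROWTH AT EVERY TIME of an ancient field (unit viscosity): `∫_{B(x,R)}‖W τ‖² ≤ A·R` for all `τ < 0`,
all centres, all radii. -/
def HasLinGrowthAllTime (A : ℝ) (W : ℝ → EuclideanSpace ℝ (Fin 3) → EuclideanSpace ℝ (Fin 3)) : Prop :=
  ∀ τ : ℝ, τ < 0 → ∀ (x : EuclideanSpace ℝ (Fin 3)) (R : ℝ), 0 < R →
    ∫ z in Metric.ball x R, ‖W τ z‖ ^ 2 ≤ A * R

/-- A slice is RADIALLY UBIQUITOUS at thickness `g` and level `η` (about the origin): the level set `{‖w‖ ≥ η}` meets the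
`g`-neighbourhood of EVERY sphere `{‖z‖ = r}`, `r ≥ 0`.  Its negation: SOME shell `{ |‖z‖ - r| ≤ g }` is quiet. -/
def RadiallyUbiquitous (g η : ℝ) (w : EuclideanSpace ℝ (Fin 3) → EuclideanSpace ℝ (Fin 3)) : Prop :=
  ∀ r : ℝ, 0 ≤ r → ∃ z : EuclideanSpace ℝ (Fin 3), |‖z‖ - r| ≤ g ∧ η ≤ ‖w z‖

/-- The SPACE-TIME DISSIPATION MEASURE of a field `W : ℝ → ℝ³ → ℝ³`: Lebesgue measure on `ℝ × ℝ³` with density `‖∇W(τ)(x)‖²`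
(operator norm of the Fréchet derivative of the slice).  On a measurable set `S`,
`dissMeasure W S = ∫⁻_{(τ,x) ∈ S} ‖fderiv ℝ (W τ) x‖ₑ²` (`MeasureTheory.withDensity_apply`). -/
def dissMeasure (W : ℝ → EuclideanSpace ℝ (Fin 3) → EuclideanSpace ℝ (Fin 3)) :
    Measure (ℝ × EuclideanSpace ℝ (Fin 3)) :=
  (volume : Measure (ℝ × EuclideanSpace ℝ (Fin 3))).withDensity fun p => ‖fderiv ℝ (W p.1) p.2‖ₑ ^ 2

/-- (L1) DISSIPATION BUDGET: a Type-I ancient mild field with all-time linear growth `A` dissipates at most `E·R` in every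
parabolic cylinder `[τ₁,τ₂] × B(x,R)` with `-τ₁ ≤ R²` (`τ₁ < τ₂ < 0`). -/
def DissipationBudget : Prop :=
  ∀ (K A : ℝ) (W : ℝ → EuclideanSpace ℝ (Fin 3) → EuclideanSpace ℝ (Fin 3)),
    IsTypeIAncientMild K W → HasLinGrowthAllTime A W →
    ∃ E : ℝ, ∀ (x : EuclideanSpace ℝ (Fin 3)) (R τ₁ τ₂ : ℝ), 0 < R → τ₁ < τ₂ → τ₂ < 0 → -τ₁ ≤ R ^ 2 →
      dissMeasure W (Set.Icc τ₁ τ₂ ×ˢ Metric.ball x R) ≤ ENNReal.ofReal (E * R)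

/-- (L2) A LEVEL POINT SPENDS DISSIPATION: for `K, A, ε > 0` there are `c, D > 0` and `0 < a < 1` such that for every
Type-I ancient mild field `W` (constant `K`) with all-time linear growth `A`, every level point `√(-τ)‖W τ x‖ > ε` forces
`∬_{[(1+a)τ, τ] × B(x, D√(-τ))} ‖∇W‖² ≥ c√(-τ)`. -/
def ViolatorDissipation : Prop :=
  ∀ (K A ε : ℝ), 0 < ε → ∃ (c D a : ℝ), 0 < c ∧ 0 < D ∧ 0 < a ∧ a < 1 ∧
    ∀ (W : ℝ → EuclideanSpace ℝ (Fin 3) → EuclideanSpace ℝ (Fin 3)),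
      IsTypeIAncientMild K W → HasLinGrowthAllTime A W →
      ∀ (τ : ℝ) (x : EuclideanSpace ℝ (Fin 3)), τ < 0 → ε < Real.sqrt (-τ) * ‖W τ x‖ →
        ENNReal.ofReal (c * Real.sqrt (-τ)) ≤
          dissMeasure W (Set.Icc ((1 + a) * τ) τ ×ˢ Metric.ball x (D * Real.sqrt (-τ)))

/-- (L3 — pure packing; PROVED in the line file as `ledgerCount_holds`) THE LEDGER COUNT.  Data: a measure `μ` on `ℝ × ℝ³`,
a space-time predicate `P` («level point»), a time `s < 0`, thickness `g ≥ 0` and constants.  Hypotheses: (U) `P`-points at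
time `s` near every sphere about `0`; (Per) one-step backward propagation `P τ x ⇒ P (36τ) x'` with `‖x' - x‖ ≤ ρ√(-τ)`;
(Spend) a `P`-point at `(τ,x)` gives `μ([(1+a)τ, τ] × B(x, D√(-τ))) ≥ c√(-τ)`; (Budget) `μ([τ₁,τ₂] × B(0,R)) ≤ E·R` when
`-τ₁ ≤ R²`.  Conclusion: `False`. -/
def LedgerCount : Prop :=
  ∀ (μ : Measure (ℝ × EuclideanSpace ℝ (Fin 3))) (P : ℝ → EuclideanSpace ℝ (Fin 3) → Prop)
    (s g ρ c D a E : ℝ),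
    s < 0 → 0 ≤ g → 0 < ρ → 0 < c → 0 < D → 0 < a → a < 1 →
    (∀ r : ℝ, 0 ≤ r → ∃ z : EuclideanSpace ℝ (Fin 3), |‖z‖ - r| ≤ g ∧ P s z) →
    (∀ (τ : ℝ) (x : EuclideanSpace ℝ (Fin 3)), τ < 0 → P τ x →
      ∃ x' : EuclideanSpace ℝ (Fin 3), ‖x' - x‖ ≤ ρ * Real.sqrt (-τ) ∧ P (36 * τ) x') →
    (∀ (τ : ℝ) (x : EuclideanSpace ℝ (Fin 3)), τ < 0 → P τ x →
      ENNReal.ofReal (c * Real.sqrt (-τ)) ≤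
        μ (Set.Icc ((1 + a) * τ) τ ×ˢ Metric.ball x (D * Real.sqrt (-τ)))) →
    (∀ (R τ₁ τ₂ : ℝ), 0 < R → τ₁ < τ₂ → τ₂ < 0 → -τ₁ ≤ R ^ 2 →
      μ (Set.Icc τ₁ τ₂ ×ˢ Metric.ball (0 : EuclideanSpace ℝ (Fin 3)) R) ≤ ENNReal.ofReal (E * R)) →
    False

/-- UBIQUITOUS-SLICE LIOUVILLE (the ledger's intermediate theorem: L1 ∧ L2 ∧ L3 ∧ backward-cone propagation ⇒ this): no slice
`W s` (`s < 0`) of a Type-I ancient mild field with all-time linear local-energy growth is radially ubiquitous at any thickness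
`g` and any level `η > 0`. -/
def UbiquitousSliceLiouville : Prop :=
  ∀ (K A g η : ℝ) (W : ℝ → EuclideanSpace ℝ (Fin 3) → EuclideanSpace ℝ (Fin 3)) (s : ℝ),
    IsTypeIAncientMild K W → s < 0 → 0 < η → HasLinGrowthAllTime A W → ¬ RadiallyUbiquitous g η (W s)

/-- (C2 — glue) UBIQUITY PASSES TO POINTWISE LIMITS OF TRANSLATES: if the `v n` are smooth with `‖Dv n‖ ≤ Λ₁` (equi-Lipschitz),
the member `v n` is ubiquitous about `y n` up to radius `d n → ∞` at thickness `g`, level `η`, and the translates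
`v n (y n + ·)` converge pointwise to `w`, then `w` is radially ubiquitous at thickness `g + 1` and level `η/2`. -/
def UbiquityToLimit : Prop :=
  ∀ (v : ℕ → EuclideanSpace ℝ (Fin 3) → EuclideanSpace ℝ (Fin 3)) (Λ₁ g η : ℝ)
    (y : ℕ → EuclideanSpace ℝ (Fin 3)) (d : ℕ → ℝ) (w : EuclideanSpace ℝ (Fin 3) → EuclideanSpace ℝ (Fin 3)),
    (∀ n, ContDiff ℝ (⊤ : ℕ∞) (v n)) → (∀ n (x : EuclideanSpace ℝ (Fin 3)), ‖iteratedFDeriv ℝ 1 (v n) x‖ ≤ Λ₁) →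
    Tendsto d atTop atTop →
    (∀ n, ∀ r : ℝ, 0 ≤ r → r ≤ d n →
      ∃ z : EuclideanSpace ℝ (Fin 3), |‖z - y n‖ - r| ≤ g ∧ η ≤ ‖v n z‖) →
    (∀ z : EuclideanSpace ℝ (Fin 3), Tendsto (fun n => v n (y n + z)) atTop (𝓝 (w z))) →
    RadiallyUbiquitous (g + 1) (η / 2) w

end Summit.NavierStokesRegularity.NavierStokesRegularity.Theorems.NearExtremalTransiencePerFlow.DissipationLedger

end
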